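import Summits.BirchSwinnertonDyer.BirchSwinnertonDyer.Theorems.ManinLocalTwoThreeShiftClassGenerationThreeHolds
import Summits.BirchSwinnertonDyer.BirchSwinnertonDyer.Theorems.ManinLocalTwoThreeTwistOrbitMinimalResidualSynthesis
import Summits.BirchSwinnertonDyer.BirchSwinnertonDyer.Theorems.ManinLocalTwoThreeManinPrimeToThreeAtNineKatoShiftLever
import HarnessLib

/-!
# C3 `ManinPrimeToThreeAtNine` BY NAME from Kato's `p = 3` fact and the reducible residual alone (E-es-19 is a theorem)

Summit `BirchSwinnertonDyer`, route `ManinLocalTwoThree` (cell bsd-f2-manin), crux C3 `ManinPrimeToThreeAtNine`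
(stmt-BirchSwinnertonDyer-22968), Euler-system line `kato_shift_three` (`Cruxes/ManinPrimeToThreeAtNine/Lines/kato_shift_three.lean`).
The line's generation leaf E-es-19 `ShiftClassGenerationThree` is a THEOREM (`shiftClassGenerationThree_holds`,
`ManinLocalTwoThreeShiftClassGenerationThreeHolds.lean`: E-es-25(3,3,1) `relativeIharaShiftVanishingBar_holds` + the Darmon–Diamond–Taylor
«irreducible ⟹ not Eisenstein» fact `not_isEisensteinEigensystem_of_hasIrreducibleModPGaloisRep_holds`, p612172).  This file records the
resulting state of C3 kernel-exactly, symmetric to `ManinLocalTwoThreeManinOddAtFourOfKatoFact` for C2: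

* **`katoShiftTwistManinThree_of_katoFact`** — the line's law `KatoShiftTwistManinThree` from the ONE named Literature statement
  F-es-18 `kato_neron_isIntegral_twistedSymbolSum_of_additive_three_polar` (Kato, Astérisque 295, Thm. 6.6 (1) + 9.7 + 12.5, polar
  reading at `p = 3`; statement-only in the tree, size XL);
* **`maninPrimeToThreeAtNine_of_katoFact_of_orbitMinimalReducible`** — the ROUTE DECL `Theses.ManinLocalTwoThree.ManinPrimeToThreeAtNine`
  BY NAME from F-es-18 and Manin at `3` on the twist-orbit-minimal `W[3]`-REDUCIBLE classes (the residual stub of the line, verbatim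
  from p2's synthesis `maninLocalTwoThree_maninPrimeToThreeAtNine_of_katoFact_of_generation_of_orbitMinimalReducible`);
* **`maninPrimeToThreeAtNine_of_katoFact_of_reducible`** — the same from F-es-18 and the unrestricted residual
  `ManinPrimeToThreeOfReducible`.

HONEST FRAMING: C3 is NOT closed — it is reduced to (i) one printed theorem of Kato not yet proved in the tree and (ii) Manin's
conjecture at `3` for optimal curves with reducible `W[3]` and `9 ∣ N` on the twist-orbit-minimal classes (7 525 optimal classes with
`9 ∣ N ≤ 5·10⁵`), which is OPEN mathematics.  Nothing about BSD is proved by this file.  No new definitions; axioms standard.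
-/

set_option autoImplicit false
set_option linter.dupNamespace false

noncomputable section

open scoped Classical MatrixGroups ModularForm
open CongruenceSubgroup WeierstrassCurve Literature.NumberTheory.EllipticCurves
  Literature.NumberTheory.EllipticCurves.ModularForms
  Summit.BirchSwinnertonDyer.Rank1Residual.ManinAdditive

namespace Summit.BirchSwinnertonDyer.BirchSwinnertonDyer.Theorems.ManinLocalTwoThree

/-- **`KatoShiftTwistManinThree` from Kato's `p = 3` fact alone** (E-es-19 discharged by `shiftClassGenerationThree_holds`).
CONDITIONAL on the named Literature statement F-es-18. [cite: Kato2004Asterisque, Thm. 9.7 (p. 189)] -/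
theorem katoShiftTwistManinThree_of_katoFact
    (hK : kato_neron_isIntegral_twistedSymbolSum_of_additive_three_polar) : KatoShiftTwistManinThree :=
  katoShiftTwistManinThree_of_katoFact_of_generation hK shiftClassGenerationThree_holds

/-- **C3 `ManinPrimeToThreeAtNine` BY NAME from Kato's `p = 3` fact and the ORBIT-MINIMAL `W[3]`-reducible residual** (p2's
synthesis with the generation law discharged).  CONDITIONAL result; the reducible residual is open mathematics.
[cite: Kato2004Asterisque, Thm. 9.7 (p. 189)] -/
theorem maninPrimeToThreeAtNine_of_katoFact_of_orbitMinimalReducible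
    (hK : kato_neron_isIntegral_twistedSymbolSum_of_additive_three_polar)
    (hB : ∀ (W : WeierstrassCurve ℚ) [W.IsElliptic] [W.IsGloballyMinimal] {N : ℕ} [NeZero N]
      (D : ModularParametrizationData W N),
      (∀ z ∈ D.L.lattice, ∃ w ∈ periodLattice D.f, z = D.c * w) → 3 ^ 2 ∣ N →
      ¬ (∃ (W' : WeierstrassCurve ℚ) (d : ℤ), W'.IsElliptic ∧ W'.IsGloballyMinimal ∧
        (d = -3) ∧ IsIsogenous W (W'.quadraticTwist (d : ℚ)) ∧
        ¬ 3 ^ 2 ∣ W'.conductorNorm ℤ) →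
      ¬ (∃ (W' : WeierstrassCurve ℚ) (q : ℕ), W'.IsElliptic ∧ W'.IsGloballyMinimal ∧
        q.Prime ∧ q ≠ 2 ∧ q ≠ 3 ∧ q ^ 2 ∣ N ∧
        IsIsogenous W (W'.quadraticTwist (((-1 : ℤ) ^ (q / 2) * q : ℤ) : ℚ)) ∧
        ¬ q ^ 2 ∣ W'.conductorNorm ℤ) →
      ¬ (∃ (W' : WeierstrassCurve ℚ) (d : ℤ), W'.IsElliptic ∧ W'.IsGloballyMinimal ∧
        (d = -1 ∨ d = 2 ∨ d = -2) ∧ 2 ^ 2 ∣ N ∧ IsIsogenous W (W'.quadraticTwist (d : ℚ)) ∧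
        ¬ 2 ^ 2 ∣ W'.conductorNorm ℤ) →
      ¬ (∃ (A : WeierstrassCurve ℚ), A.IsElliptic ∧ A.IsGloballyMinimal ∧ 2 ^ 4 ∣ N ∧
        2 ^ 2 ∣ A.conductorNorm ℤ ∧ A.conductorNorm ℤ ∣ N ∧ A.conductorNorm ℤ < N ∧
        IsIsogenous W (A.quadraticTwist ((-1 : ℤ) : ℚ))) →
      ¬ (∃ (A : WeierstrassCurve ℚ) (_ : A.IsElliptic) (_ : A.IsGloballyMinimal) (N' : ℕ) (_ : NeZero N')
        (D' : ModularParametrizationData A N') (d : ℤ) (C : WeierstrassCurve ℚ) (u : VariableChange ℚ),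
        C.IsElliptic ∧ C.IsGloballyMinimal ∧
        (∀ z ∈ D'.L.lattice, ∃ w ∈ periodLattice D'.f, z = D'.c * w) ∧ (d = 2 ∨ d = -2) ∧ 2 ^ 6 ∣ N ∧
        2 ^ 2 ∣ A.conductorNorm ℤ ∧ A.conductorNorm ℤ ∣ N ∧
        IsIsogenous W (A.quadraticTwist (d : ℚ)) ∧ u • A.quadraticTwist (d : ℚ) = C ∧
        C.Δ = (d : ℚ) ^ 6 * A.Δ ∧
        (A.conductorNorm ℤ < N ∨ A.minimalDiscriminantInt.natAbs < W.minimalDiscriminantInt.natAbs)) →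
      ¬ (∃ (A : WeierstrassCurve ℚ) (_ : A.IsElliptic) (_ : A.IsGloballyMinimal)
        (D' : ModularParametrizationData A N) (q : ℕ) (C : WeierstrassCurve ℚ) (u : VariableChange ℚ),
        C.IsElliptic ∧ C.IsGloballyMinimal ∧
        (∀ z ∈ D'.L.lattice, ∃ w ∈ periodLattice D'.f, z = D'.c * w) ∧ q.Prime ∧ q ≠ 2 ∧ q ^ 2 ∣ N ∧
        IsIsogenous C W ∧ u • A.quadraticTwist (((-1 : ℤ) ^ (q / 2) * q : ℤ) : ℚ) = C ∧
        C.Δ = ((((-1 : ℤ) ^ (q / 2) * q : ℤ)) : ℚ) ^ 6 * A.Δ ∧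
        A.minimalDiscriminantInt.natAbs < W.minimalDiscriminantInt.natAbs) →
      ¬ W.HasIrreducibleModPGaloisRep 3 → ¬ (3 : ℤ) ∣ D.c) :
    Summit.BirchSwinnertonDyer.BirchSwinnertonDyer.Theses.ManinLocalTwoThree.ManinPrimeToThreeAtNine :=
  Summit.BirchSwinnertonDyer.BirchSwinnertonDyer.Theorems.maninLocalTwoThree_maninPrimeToThreeAtNine_of_katoFact_of_generation_of_orbitMinimalReducible
    hK shiftClassGenerationThree_holds hB

/-- **C3 `ManinPrimeToThreeAtNine` BY NAME from Kato's `p = 3` fact and the UNRESTRICTED reducible residual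
`ManinPrimeToThreeOfReducible`.**  CONDITIONAL result. [cite: Kato2004Asterisque, Thm. 9.7 (p. 189)] -/
theorem maninPrimeToThreeAtNine_of_katoFact_of_reducible
    (hK : kato_neron_isIntegral_twistedSymbolSum_of_additive_three_polar) (hB : ManinPrimeToThreeOfReducible) :
    Summit.BirchSwinnertonDyer.BirchSwinnertonDyer.Theses.ManinLocalTwoThree.ManinPrimeToThreeAtNine :=
  maninPrimeToThreeAtNine_of_katoFact_of_generation_of_reducible hK shiftClassGenerationThree_holds hB

end Summit.BirchSwinnertonDyer.BirchSwinnertonDyer.Theorems.ManinLocalTwoThree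

end
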